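import Summits.ResolutionOfSingularities.ResolutionOfSingularities.Theorems.EquisingularLiftEquisingularLiftNatSmoothConeBlowupStalk
import Summits.ResolutionOfSingularities.ResolutionOfSingularities.Theorems.EquisingularLiftEquisingularLiftNatRegularOfSpecialFibre
import Literature.AlgebraicGeometry.Resolution.MonomialOrderReductionUnit
import HarnessLib

/-!
# [OURS · L1 W4.5(b) · EL♮(3)] T-EBETA-PRIME, part 5 (scheme level, global): the strict transform of a hypersurface
# under a blow-up is a REGULAR scheme when it is regular over the centre and the hypersurface is regular off it

Support file of the crux chain w45b (cell `res-hironaka`, LADDER-RESOLUTION rung L, slot W4.5(b)), working crux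
**EL♮ = `Theses.EquisingularLift.EquisingularLiftNat`** (stmt-ResolutionOfSingularities-20038) and its `n = 3` child
`EquisingularLiftNatThree` (stmt-ResolutionOfSingularities-20148), registered stub `stub_elnat_three_isolated_nontc`
(K4.5e arm T, route T-B (E-β′): clause (b) `Scheme.IsRegular C.subscheme` of the HorizChainE1 step whose centre is
`C = St_τ(D)`). OURS; NOT a statement of any manuscript; AI-written, weaker than expert review. Filed
`--supports stmt-ResolutionOfSingularities-20148 --as helper` by res-L1-w45b-stub-3 (object T-EBETA-PRIME; parts 1–4 =
`…NatSmoothConeBlowupChart` p511641, `…NatSmoothConeBlowup` p512906, `…NatTieCubicBlowup` p514128, `…NatSmoothConeBlowupStalk`).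

WHAT. The two halves of «the strict transform `V(St_τ(K))` is regular»:
* OVER the centre (`τ x' ∈ supp J`): part 4 (`isRegularLocalRing_stalk_quotient_strictTransform_of_mem_span`, smooth
  projectivised tangent cone; or `_tieCubic` at an S-F tie point);
* OFF the centre (`τ x' ∉ supp J`): `isRegularLocalRing_stalk_quotient_strictTransform_of_not_mem_support` — there the
  blow-up is a local isomorphism (`IsBlowup.isIso_stalkMap_of_not_mem_support`) and `St_τ(K)_{x'} = K_{τ x'}·𝒪_{X',x'}`
  (`stalkIdeal_strictTransformIdeal_of_not_mem_support`), so `𝒪_{X',x'}/St_τ(K)_{x'} ≅ 𝒪_{X,τ x'}/K_{τ x'}` is regular as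
  soon as `V(K)` is regular at `τ x'`;
* `mem_support_of_mem_support_strictTransformIdeal_of_not_mem` — off the centre a point of the strict transform maps
  to a point of `V(K)`;
* **`isRegular_strictTransform_subscheme_of_forall`** — GLOBAL ASSEMBLY over a local base `Spec O` (res-type-032's
  `Scheme.isRegular_subscheme_of_forall_over_closedPoint`, p504250: for `V(St_τ(K))` universally closed over `Spec O` it
  suffices to check the special-fibre points): if every special-fibre point of `V(St_τ(K))` over the centre has a
  regular quotient stalk (part 4), and `V(K)` is regular (`𝒪_{X,x}/K_x` regular) at every special-fibre point of
  `supp K ∖ supp J`, then **`V(St_τ(K))` is a regular scheme** — clause (b) for the (E-β′) centre `C = Bl_{q̂}(D)`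
  (`D` regular off the tie points: its special fibre is smooth there).

References: The Stacks Project, Tags 0804, 02OS, 080C; Liu, *Algebraic Geometry and Arithmetic Curves*, Thm. 8.1.19 (a).
-/

set_option linter.dupNamespace false -- mandated namespace `Summit.<Summit>.<Problem>` of this single-conjunct summit

noncomputable section

open CategoryTheory AlgebraicGeometry TopologicalSpace IsLocalRing
open Literature.AlgebraicGeometry.Resolution
open Summit.ResolutionOfSingularities.ResolutionOfSingularities.Cruxes.EquisingularLift.StrataSplit

namespace Summit.ResolutionOfSingularities.ResolutionOfSingularities.Cruxes.EquisingularLiftNat.Sections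

universe u

section OffCentre

variable {X X' : Scheme.{u}} {τ : X' ⟶ X} {J : X.IdealSheafData}

/-- **Off the centre the strict transform has the local rings of the original subscheme.** For a blow-up `τ` along
`J` and `x'` with `τ x' ∉ supp J`: if `𝒪_{X,τ x'}/K_{τ x'}` is a regular local ring then so is `𝒪_{X',x'}/St_τ(K)_{x'}`
(`τ^♯_{x'}` is an isomorphism and `St_τ(K)_{x'} = K_{τ x'}·𝒪_{X',x'}`). [cite: StacksProject, Tag 02OS] -/
theorem isRegularLocalRing_stalk_quotient_strictTransform_of_not_mem_support [IsLocallyNoetherian X']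
    (hτ : IsBlowup τ J) (K : X.IdealSheafData) (x' : X') (hx' : τ x' ∉ (J.support : Set X))
    (h : IsRegularLocalRing (X.presheaf.stalk (τ x') ⧸ stalkIdeal K (τ x'))) :
    IsRegularLocalRing (X'.presheaf.stalk x' ⧸ stalkIdeal (strictTransformIdeal τ J K) x') := by
  haveI := hτ.isIso_stalkMap_of_not_mem_support hx'
  let e : X.presheaf.stalk (τ x') ≃+* X'.presheaf.stalk x' := (asIso (τ.stalkMap x')).commRingCatIsoToRingEquiv
  have hSt : stalkIdeal (strictTransformIdeal τ J K) x' = (stalkIdeal K (τ x')).map (e : _ →+* _) := by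
    rw [stalkIdeal_strictTransformIdeal_of_not_mem_support J K hx']
    rfl
  haveI := h
  exact IsRegularLocalRing.of_ringEquiv (Ideal.quotientEquiv _ _ e hSt)

/-- Off the centre, a point of the strict transform of `V(K)` lies over a point of `V(K)`. [folklore] -/
theorem mem_support_of_mem_support_strictTransformIdeal_of_not_mem [IsLocallyNoetherian X']
    (K : X.IdealSheafData) (x' : X') (hx' : τ x' ∉ (J.support : Set X))
    (hx'St : x' ∈ (strictTransformIdeal τ J K).support) : τ x' ∈ (K.support : Set X) := by
  by_contra hK
  have htop : stalkIdeal (strictTransformIdeal τ J K) x' = ⊤ := by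
    rw [stalkIdeal_strictTransformIdeal_of_not_mem_support J K hx', stalkIdeal_eq_top_of_not_mem_support hK,
      Ideal.map_top]
  have hle := (mem_support_iff_stalkIdeal_le _ x').mp hx'St
  rw [htop] at hle
  exact (maximalIdeal.isMaximal (X'.presheaf.stalk x')).ne_top (top_le_iff.mp hle)

end OffCentre

section Global

variable {O : Type u} [CommRing O] [IsLocalRing O]
variable {X X' : Scheme.{u}} {τ : X' ⟶ X} {J : X.IdealSheafData}

/-- **THE STRICT TRANSFORM IS A REGULAR SCHEME (global assembly over a local base).** Let `q : X → Spec O` with `O` local,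
`τ : X' → X` a blow-up along `J` (`X'` locally Noetherian), `K` an ideal sheaf on `X`, and suppose `V(St_τ(K))` is universally
closed over `Spec O` (e.g. `X` proper over `O`: `τ` and closed immersions are proper). IF (centre) every point `x'` of
`V(St_τ(K))` over the closed point with `τ x' ∈ supp J` has regular `𝒪_{X',x'}/St_τ(K)_{x'}` — supplied by part 4
(`isRegularLocalRing_stalk_quotient_strictTransform_of_mem_span` under the smooth-tangent-cone hypothesis, or `_tieCubic`) —
AND (off centre) `𝒪_{X,x}/K_x` is regular at every point `x ∈ supp K ∖ supp J` over the closed point, THEN `V(St_τ(K))` is a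
REGULAR scheme: clause (b) `IsRegular C.subscheme` of the HorizChainE1 step with centre `C = St_τ(K)` (for (E-β′):
`C = Bl_{q̂}(D)`). [cite: Liu2002, Thm. 8.1.19 (a)] [cite: StacksProject, Tag 02OS] [OURS · L1 W4.5b] T-EBETA-PRIME global
form toward `stub_elnat_three_isolated_nontc` of `EquisingularLiftNatThree` (stmt-ResolutionOfSingularities-20148); NOT a
statement of the manuscript. -/
theorem isRegular_strictTransform_subscheme_of_forall [IsLocallyNoetherian X'] (q : X ⟶ Spec (.of O))
    (hτ : IsBlowup τ J) (K : X.IdealSheafData)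
    [UniversallyClosed ((strictTransformIdeal τ J K).subschemeι ≫ τ ≫ q)]
    (hcentre : ∀ x' ∈ (strictTransformIdeal τ J K).support, q (τ x') = IsLocalRing.closedPoint O →
      τ x' ∈ (J.support : Set X) →
        IsRegularLocalRing (X'.presheaf.stalk x' ⧸ stalkIdeal (strictTransformIdeal τ J K) x'))
    (hoff : ∀ x ∈ K.support, q x = IsLocalRing.closedPoint O → x ∉ (J.support : Set X) →
      IsRegularLocalRing (X.presheaf.stalk x ⧸ stalkIdeal K x)) :
    Scheme.IsRegular (strictTransformIdeal τ J K).subscheme := by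
  refine Scheme.isRegular_subscheme_of_forall_over_closedPoint (τ ≫ q) _ fun x' hx'C hq => ?_
  have hq' : q (τ x') = IsLocalRing.closedPoint O := by rw [← Scheme.Hom.comp_apply]; exact hq
  by_cases hJ : τ x' ∈ (J.support : Set X)
  · exact hcentre x' hx'C hq' hJ
  · exact isRegularLocalRing_stalk_quotient_strictTransform_of_not_mem_support hτ K x' hJ
      (hoff _ (mem_support_of_mem_support_strictTransformIdeal_of_not_mem K x' hJ hx'C) hq' hJ)

end Global

end Summit.ResolutionOfSingularities.ResolutionOfSingularities.Cruxes.EquisingularLiftNat.Sections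

end
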